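import Literature.Analysis.FluidPDE.CKNMorreyReduced
import Literature.Analysis.FluidPDE.CKNMorreyReducedAlgebra
import HarnessLib

/-!
# Lemarié-Rieusset 2016, §13.9, Step 2: the recursions (13.40)–(13.47) at one centre and scale

Analysis/FluidPDE file in the decomposition of the named fact
`Literature.Analysis.FluidPDE.lemarieRieusset_ckn_criterion` (Lemarié-Rieusset 2016, Thm. 13.8),
towards `LemarieRieusset2016.lemma13_4` from Lemma 13.3 (`LemarieRieusset2016.lemma13_3`) and
the interpolation inequality. Here the estimates of Lemma 13.3 at one centre `z ∈ Q_{r₀}(z₀)` and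
one pair of scales `(κρ, ρ)`, `ρ ≤ r₀`, `Q_{4r₀}(z₀) ⊆ Ω`, are turned into the real recursions that
the abstract iteration (`CKNMorreyIteration.lean`) consumes (pp. 471–473):

* the **reduced quantities** as real numbers (p. 471): `alphaR u G τ₂ r z = α_r(z) =
  r^{-(3 - 10/τ₂)} (U_r + V_r)`, `betaR G r z = β_r(z) = r⁻¹ V_r`,
  `pR p q₀ τ₂ r z = p_r(z) = r^{-5(1 - 2q₀/τ₂)} P_r` (via `ENNReal.toReal`; the quantities are
  finite on cylinders inside `Ω`);
* `LemarieRieusset2016.recursion_at` — for `0 < κ ≤ 1/2` with `C κ^λ ≤ 1/4`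
  (`λ = min(10/τ₂, 10q₀/τ₂ - 2)`, p. 472) and `C_κ = (C + 1) κ⁻⁴`: (13.40)
  `α_{κρ} ≤ ¼ α_ρ + C_κ β_ρ^{1/2} α_ρ + C_κ q_ρ^{1/q₀} α_ρ^{1/2} + C_κ ‖f‖^{7/10} ρ^γ α_ρ^{1/2}`
  (`q_ρ = ρ^{q₀(1-5/τ₂)} p_ρ`, `γ = 2 - 5/τ₀ + 5/τ₂`), (13.41)
  `q_{κρ} ≤ ¼ q_ρ + C_κ α_ρ^{q₀/2} β_ρ^{q₀/2}`, (13.44) `p_{κρ} ≤ ¼ p_ρ + C_κ ρ^{5q₀/τ₂ - q₀} α_ρ^{q₀/2} β_ρ^{q₀/2}`,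
  and `β_ρ ≤ ρ^{2 - 10/τ₂} α_ρ` (which gives the `β`-free forms (13.42)–(13.47)).

Everything is **proved** (from the named fact's inequality taken as a hypothesis `hC`).

## References

* P. G. Lemarié-Rieusset, *The Navier–Stokes Problem in the 21st Century*, CRC Press (2016),
  §13.9, Step 2, (13.36)–(13.47), pp. 471–473. [LemarieRieusset2016]
-/

noncomputable section

open MeasureTheory Set Function Filter Topology TopologicalSpace Metric
open scoped NNReal ENNReal InnerProductSpace RealInnerProductSpace Laplacian

namespace Literature.Analysis.FluidPDE

/-- Local notation for physical space `ℝ³ = EuclideanSpace ℝ (Fin 3)`. -/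
local notation "ℝ³" => EuclideanSpace ℝ (Fin 3)

namespace LemarieRieusset2016

/-! ### The reduced quantities as real numbers -/

/-- `α_r(t, x) = r^{-(3 - 10/τ₂)} (U_r(t, x) + V_r(t, x))` (Lemarié-Rieusset 2016, p. 471), as a
real number (`ENNReal.toReal` of the finite quantities `U_r`, `V_r`). [cite: LemarieRieusset2016, §13.9 p. 471] -/
def alphaR (u : ℝ → ℝ³ → ℝ³) (G : ℝ → ℝ³ → ℝ³ →L[ℝ] ℝ³) (τ₂ r : ℝ) (z : ℝ × ℝ³) : ℝ :=
  ((energyU u r z).toReal + (gradV G r z).toReal) / r ^ (3 - 10 / τ₂)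

/-- `β_r(t, x) = r⁻¹ V_r(t, x)` (Lemarié-Rieusset 2016, p. 471), as a real number. [cite: LemarieRieusset2016, §13.9 p. 471] -/
def betaR (G : ℝ → ℝ³ → ℝ³ →L[ℝ] ℝ³) (r : ℝ) (z : ℝ × ℝ³) : ℝ :=
  (gradV G r z).toReal / r

/-- `p_r(t, x) = r^{-5(1 - 2q₀/τ₂)} P_r(t, x)` (Lemarié-Rieusset 2016, p. 471), as a real number. [cite: LemarieRieusset2016, §13.9 p. 471] -/
def pR (p : ℝ → ℝ³ → ℝ) (q₀ τ₂ r : ℝ) (z : ℝ × ℝ³) : ℝ :=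
  (pressureP p q₀ r z).toReal / r ^ (5 * (1 - 2 * q₀ / τ₂))

/-- `α_r ≥ 0`. [folklore] -/
theorem alphaR_nonneg (u : ℝ → ℝ³ → ℝ³) (G : ℝ → ℝ³ → ℝ³ →L[ℝ] ℝ³) (τ₂ : ℝ) {r : ℝ} (hr : 0 ≤ r)
    (z : ℝ × ℝ³) : 0 ≤ alphaR u G τ₂ r z :=
  div_nonneg (add_nonneg ENNReal.toReal_nonneg ENNReal.toReal_nonneg) (Real.rpow_nonneg hr _)

/-- `β_r ≥ 0`. [folklore] -/
theorem betaR_nonneg (G : ℝ → ℝ³ → ℝ³ →L[ℝ] ℝ³) {r : ℝ} (hr : 0 ≤ r) (z : ℝ × ℝ³) :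
    0 ≤ betaR G r z :=
  div_nonneg ENNReal.toReal_nonneg hr

/-- `p_r ≥ 0`. [folklore] -/
theorem pR_nonneg (p : ℝ → ℝ³ → ℝ) (q₀ τ₂ : ℝ) {r : ℝ} (hr : 0 ≤ r) (z : ℝ × ℝ³) :
    0 ≤ pR p q₀ τ₂ r z :=
  div_nonneg ENNReal.toReal_nonneg (Real.rpow_nonneg hr _)

/-- `β_ρ ≤ ρ^{2 - 10/τ₂} α_ρ`, i.e. `V_ρ ≤ U_ρ + V_ρ` (Lemarié-Rieusset 2016, p. 472: "since
`β_ρ ≤ ρ^{2 - 10/τ₂} α_ρ`"). [cite: LemarieRieusset2016, §13.9 p. 472] -/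
theorem betaR_le_alphaR (u : ℝ → ℝ³ → ℝ³) (G : ℝ → ℝ³ → ℝ³ →L[ℝ] ℝ³) (τ₂ : ℝ) {ρ : ℝ} (hρ : 0 < ρ)
    (z : ℝ × ℝ³) : betaR G ρ z ≤ ρ ^ (3 - 10 / τ₂ - 1) * alphaR u G τ₂ ρ z := by
  have h : ρ ^ (3 - 10 / τ₂ - 1) * alphaR u G τ₂ ρ z =
      ((energyU u ρ z).toReal + (gradV G ρ z).toReal) / ρ := by
    rw [alphaR, Real.rpow_sub_one hρ.ne']
    field_simp
  rw [h, betaR]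
  gcongr
  linarith [ENNReal.toReal_nonneg (a := energyU u ρ z)]

/-! ### Cylinders around centres in `Q_{r₀}(z₀)` stay in the room `Q_{4r₀}(z₀)` -/

/-- If `z ∈ Q_{r₀}(z₀)` and `0 ≤ s ≤ 3r₀` then `Q_s(z) ⊆ Q_{4r₀}(z₀)`
(`|σ - t₀| < s² + r₀² ≤ 10 r₀² ≤ 16 r₀²`, `|y - x₀| < s + r₀ ≤ 4r₀`). [folklore] -/
theorem cylinder_subset_room {z z₀ : ℝ × ℝ³} {r₀ s : ℝ}
    (hz : z ∈ FluidPDE.parabolicCylinderCentered r₀ z₀) (hs : 0 ≤ s) (hs3 : s ≤ 3 * r₀) :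
    FluidPDE.parabolicCylinderCentered s z ⊆ FluidPDE.parabolicCylinderCentered (4 * r₀) z₀ := by
  intro w hw
  rw [FluidPDE.mem_parabolicCylinderCentered] at hz hw ⊢
  obtain ⟨⟨h1, h2⟩, h3⟩ := hz
  obtain ⟨⟨hw1, hw2⟩, hw3⟩ := hw
  have hr₀ : 0 < r₀ := lt_of_le_of_lt dist_nonneg h3
  have hs2 : s ^ 2 ≤ 9 * r₀ ^ 2 := by nlinarith
  refine ⟨⟨by nlinarith, by nlinarith⟩, ?_⟩
  calc dist w.2 z₀.2 ≤ dist w.2 z.2 + dist z.2 z₀.2 := dist_triangle _ _ _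
    _ < s + r₀ := add_lt_add hw3 h3
    _ ≤ 4 * r₀ := by linarith

/-! ### The recursions at one centre and one pair of scales -/

-- The declaration below is long (three chained estimates); give the elaborator more room.
set_option maxHeartbeats 1000000 in
/-- **(13.40), (13.41), (13.44) at one centre** (Lemarié-Rieusset 2016, pp. 471–473). Fix the
exponents of §13.9 (`1 < q₀ ≤ 3/2`, `5 < τ₂ < 5q₀`, `τ₀ > 0`) and let `C` be the constant of
Lemma 13.3 for `(ν, q₀)` (hypothesis `hC`: the inequalities (13.30)–(13.31)). Let `(u, p, f)` satisfy
the standing hypotheses on `Ω` with `1_Ω f ∈ ℳ₂^{10/7,τ₀}` (constant `M`), `Q_{4r₀}(z₀) ⊆ Ω`,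
`z ∈ Q_{r₀}(z₀)`, `0 < ρ ≤ r₀`, `0 < κ ≤ 1/2` with `C κ^{min(10/τ₂, 10q₀/τ₂ - 2)} ≤ 1/4`, and put
`C_κ = (C + 1) κ⁻⁴`, `c = q₀(1 - 5/τ₂)`, `γ = 2 - 5/τ₀ + 5/τ₂`. Then
`α_{κρ} ≤ ¼ α_ρ + C_κ β_ρ^{1/2} α_ρ + C_κ (ρ^c p_ρ)^{1/q₀} α_ρ^{1/2} + C_κ M^{7/10} ρ^γ α_ρ^{1/2}` (13.40),
`(κρ)^c p_{κρ} ≤ ¼ ρ^c p_ρ + C_κ α_ρ^{q₀/2} β_ρ^{q₀/2}` (13.41) and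
`p_{κρ} ≤ ¼ p_ρ + C_κ ρ^{5q₀/τ₂ - q₀} α_ρ^{q₀/2} β_ρ^{q₀/2}` (13.44), all at the centre `z`. [cite: LemarieRieusset2016, §13.9 Step 2 (13.40)–(13.44) pp. 471–473] -/
theorem recursion_at {ν q₀ τ₀ τ₂ : ℝ} {C : ℝ≥0} (hq₀ : 1 < q₀) (hq₀' : q₀ ≤ 3 / 2) (h5τ₂ : 5 < τ₂)
    (hτ₂q : τ₂ < 5 * q₀) (hτ₀ : 0 < τ₀)
    (hC : ∀ (Ω : Opens (ℝ × ℝ³)) (f u : ℝ → ℝ³ → ℝ³) (p : ℝ → ℝ³ → ℝ)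
      (G : ℝ → ℝ³ → ℝ³ →L[ℝ] ℝ³), IsSuitableOn Ω ν q₀ f u p G →
      ∀ (z₀ : ℝ × ℝ³) (r₀ : ℝ), 0 < r₀ →
        FluidPDE.parabolicCylinderCentered (4 * r₀) z₀ ⊆ (Ω : Set (ℝ × ℝ³)) →
        ∀ z ∈ FluidPDE.parabolicCylinderCentered r₀ z₀, ∀ (r ρ : ℝ), 0 < r → r ≤ ρ / 2 → ρ ≤ r₀ →
          energyU u r z + gradV G r z ≤
              C * (ENNReal.ofReal ((r / ρ) ^ 3) * energyU u ρ z +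
                ENNReal.ofReal (ρ ^ (1 / 2 : ℝ) / r) * (energyU u ρ z + gradV G ρ z) *
                  gradV G ρ z ^ (1 / 2 : ℝ) +
                ENNReal.ofReal (r⁻¹ * ρ ^ (2 + 3 / 2 - 5 / q₀)) * pressureP p q₀ ρ z ^ (1 / q₀) *
                  energyU u ρ z ^ (1 / 2 : ℝ) +
                (energyU u ρ z + gradV G ρ z) ^ (1 / 2 : ℝ) * forceF f ρ z ^ (7 / 10 : ℝ)) ∧
            pressureP p q₀ r z ≤
              C * (ENNReal.ofReal ((r / ρ) ^ 3) * pressureP p q₀ ρ z +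
                ENNReal.ofReal (r ^ (5 * (1 - 2 * q₀ / 3)) * ρ ^ (q₀ / 3)) *
                  energyU u ρ z ^ (q₀ / 2) * gradV G ρ z ^ (q₀ / 2)))
    {Ω : Opens (ℝ × ℝ³)} {f u : ℝ → ℝ³ → ℝ³} {p : ℝ → ℝ³ → ℝ} {G : ℝ → ℝ³ → ℝ³ →L[ℝ] ℝ³}
    (hS : IsSuitableOn Ω ν q₀ f u p G) {M : ℝ≥0}
    (hM : ∀ (z' : ℝ × ℝ³) (r' : ℝ), 0 < r' →
      ∫⁻ w in FluidPDE.parabolicCylinderCentered r' z' ∩ (Ω : Set (ℝ × ℝ³)),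
          (fun w => ‖f w.1 w.2‖ₑ) w ^ (10 / 7 : ℝ) ≤
        M * ENNReal.ofReal (r' ^ (5 * (1 - 10 / 7 / τ₀))))
    {z₀ z : ℝ × ℝ³} {r₀ ρ κ : ℝ} (hr₀ : 0 < r₀)
    (hroom : FluidPDE.parabolicCylinderCentered (4 * r₀) z₀ ⊆ (Ω : Set (ℝ × ℝ³)))
    (hz : z ∈ FluidPDE.parabolicCylinderCentered r₀ z₀) (hρ : 0 < ρ) (hρr₀ : ρ ≤ r₀) (hκ0 : 0 < κ)
    (hκ : κ ≤ 1 / 2) (hCκ : (C : ℝ) * κ ^ min (10 / τ₂) (10 * q₀ / τ₂ - 2) ≤ 1 / 4) :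
    alphaR u G τ₂ (κ * ρ) z ≤ alphaR u G τ₂ ρ z / 4 +
        (C + 1) * κ ^ (-(4 : ℝ)) * betaR G ρ z ^ (1 / 2 : ℝ) * alphaR u G τ₂ ρ z +
        (C + 1) * κ ^ (-(4 : ℝ)) * (ρ ^ (q₀ * (1 - 5 / τ₂)) * pR p q₀ τ₂ ρ z) ^ (1 / q₀) *
          alphaR u G τ₂ ρ z ^ (1 / 2 : ℝ) +
        (C + 1) * κ ^ (-(4 : ℝ)) * (M : ℝ) ^ (7 / 10 : ℝ) * ρ ^ (2 - 5 / τ₀ + 5 / τ₂) *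
          alphaR u G τ₂ ρ z ^ (1 / 2 : ℝ) ∧
      (κ * ρ) ^ (q₀ * (1 - 5 / τ₂)) * pR p q₀ τ₂ (κ * ρ) z ≤
        ρ ^ (q₀ * (1 - 5 / τ₂)) * pR p q₀ τ₂ ρ z / 4 +
          (C + 1) * κ ^ (-(4 : ℝ)) * alphaR u G τ₂ ρ z ^ (q₀ / 2) * betaR G ρ z ^ (q₀ / 2) ∧
      pR p q₀ τ₂ (κ * ρ) z ≤ pR p q₀ τ₂ ρ z / 4 +
        (C + 1) * κ ^ (-(4 : ℝ)) * ρ ^ (5 * q₀ / τ₂ - q₀) * alphaR u G τ₂ ρ z ^ (q₀ / 2) *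
          betaR G ρ z ^ (q₀ / 2) := by
  -- positivity bookkeeping
  have hq₀0 : 0 < q₀ := by linarith
  have hτ₂0 : 0 < τ₂ := by linarith
  have hκ1 : κ ≤ 1 := hκ.trans (by norm_num)
  have hκρ : 0 < κ * ρ := mul_pos hκ0 hρ
  set a : ℝ := 3 - 10 / τ₂ with ha
  set b : ℝ := 5 * (1 - 2 * q₀ / τ₂) with hb
  set c : ℝ := q₀ * (1 - 5 / τ₂) with hc
  set lam : ℝ := min (10 / τ₂) (10 * q₀ / τ₂ - 2) with hlam
  set Cκ : ℝ := ((C : ℝ) + 1) * κ ^ (-(4 : ℝ)) with hCκdef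
  have hC0 : (0 : ℝ) ≤ C := C.coe_nonneg
  have h10τ₂ : 10 / τ₂ < 2 := by rw [div_lt_iff₀ hτ₂0]; linarith
  have h10q : 2 < 10 * q₀ / τ₂ := by rw [lt_div_iff₀ hτ₂0]; linarith
  have ha1 : 1 < a := by rw [ha]; linarith
  have ha3 : a < 3 := by
    have : 0 < 10 / τ₂ := by positivity
    rw [ha]; linarith
  have hc0 : 0 < c := by
    rw [hc]; refine mul_pos hq₀0 ?_; rw [sub_pos, div_lt_one hτ₂0]; linarith
  have hlam0 : 0 < lam := lt_min (by positivity) (by linarith)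
  have hlam1 : lam ≤ 10 / τ₂ := min_le_left _ _
  have hlam2 : lam ≤ 10 * q₀ / τ₂ - 2 := min_le_right _ _
  have h5e : 5 * q₀ * (2 / 3 - 2 / τ₂) ≤ 4 := by
    have h' : 5 * q₀ * (2 / 3 - 2 / τ₂) = 10 * q₀ / 3 - 10 * q₀ / τ₂ := by ring
    rw [h']; linarith
  have hκ4 : 0 < κ ^ (-(4 : ℝ)) := Real.rpow_pos_of_pos hκ0 _
  have hCκ0 : 0 ≤ Cκ := mul_nonneg (by linarith) hκ4.le
  -- powers of `κ`: `κ^e ≤ κ^λ` for `e ≥ λ`, and `C (κ⁻¹)^e ≤ C_κ` for `e ≤ 4`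
  have hκle : ∀ {e : ℝ}, lam ≤ e → (C : ℝ) * κ ^ e ≤ 1 / 4 := fun {e} he =>
    (mul_le_mul_of_nonneg_left (Real.rpow_le_rpow_of_exponent_ge hκ0 hκ1 he) hC0).trans hCκ
  have hκinv : ∀ {e : ℝ}, e ≤ 4 → (C : ℝ) * κ⁻¹ ^ e ≤ Cκ := by
    intro e he
    rw [Real.inv_rpow hκ0.le, ← Real.rpow_neg hκ0.le, hCκdef]
    exact mul_le_mul (by linarith) (Real.rpow_le_rpow_of_exponent_ge hκ0 hκ1 (by linarith))
      (Real.rpow_nonneg hκ0.le _) (by linarith)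
  -- the cylinders at `z` are inside the room
  have hsubρ : FluidPDE.parabolicCylinderCentered ρ z ⊆ (Ω : Set (ℝ × ℝ³)) :=
    (cylinder_subset_room hz hρ.le (by linarith)).trans hroom
  have hsubκ : FluidPDE.parabolicCylinderCentered (κ * ρ) z ⊆ (Ω : Set (ℝ × ℝ³)) :=
    (FluidPDE.parabolicCylinderCentered_mono hκρ.le (by nlinarith) z).trans hsubρ
  -- finiteness at scale `ρ`
  obtain ⟨CE, hCE⟩ := hS.energy
  have hUfin : energyU u ρ z ≠ ∞ := ne_top_of_le_ne_top ENNReal.coe_ne_top (energyU_le_of_subset hCE hsubρ)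
  have hVfin : gradV G ρ z ≠ ∞ := (gradV_lt_top_of_subset hS.gradient_sq_lt_top hsubρ).ne
  have hPfin : pressureP p q₀ ρ z ≠ ∞ := (pressureP_lt_top_of_subset hS.pressure_lt_top hsubρ).ne
  have hFle : forceF f ρ z ≤ M * ENNReal.ofReal (ρ ^ (5 * (1 - 10 / 7 / τ₀))) :=
    forceF_le_of_morrey hM hρ hsubρ
  have hFfin : forceF f ρ z ≠ ∞ :=
    ne_top_of_le_ne_top (ENNReal.mul_ne_top ENNReal.coe_ne_top ENNReal.ofReal_ne_top) hFle
  -- Lemma 13.3 at `(z, κρ, ρ)` and its real form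
  obtain ⟨h30, h31⟩ := hC Ω f u p G hS z₀ r₀ hr₀ hroom z hz (κ * ρ) ρ hκρ (by nlinarith) hρr₀
  obtain ⟨-, -, -, h30r, h31r⟩ := lemma13_3_real (C := C) hq₀0 hκρ hρ hUfin hVfin hPfin hFfin h30 h31
  -- names for the real values
  set U : ℝ := (energyU u ρ z).toReal with hUdef
  set V : ℝ := (gradV G ρ z).toReal with hVdef
  set P : ℝ := (pressureP p q₀ ρ z).toReal with hPdef
  set F : ℝ := (forceF f ρ z).toReal with hFdef
  set Uκ : ℝ := (energyU u (κ * ρ) z).toReal with hUκdef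
  set Vκ : ℝ := (gradV G (κ * ρ) z).toReal with hVκdef
  set Pκ : ℝ := (pressureP p q₀ (κ * ρ) z).toReal with hPκdef
  have hU0 : 0 ≤ U := ENNReal.toReal_nonneg
  have hV0 : 0 ≤ V := ENNReal.toReal_nonneg
  have hP0 : 0 ≤ P := ENNReal.toReal_nonneg
  have hF0 : 0 ≤ F := ENNReal.toReal_nonneg
  have hFM : F ≤ M * ρ ^ (5 * (1 - 10 / 7 / τ₀)) := by
    have := ENNReal.toReal_mono (ENNReal.mul_ne_top ENNReal.coe_ne_top ENNReal.ofReal_ne_top) hFle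
    rwa [ENNReal.toReal_mul, ENNReal.coe_toReal,
      ENNReal.toReal_ofReal (Real.rpow_nonneg hρ.le _)] at this
  -- (13.38)–(13.39) with `r = κρ`
  obtain ⟨h38, h39⟩ := reduced_estimates (τ₀ := τ₀) (τ₂ := τ₂) hC0 M.coe_nonneg hq₀0 hτ₀ hτ₂0 hκρ
    hρ hU0 hV0 hP0 hF0 h30r h31r hFM
  rw [← ha, ← hb] at h38 h39
  have e1 : κ * ρ / ρ = κ := by field_simp
  have e2 : ρ / (κ * ρ) = κ⁻¹ := by field_simp
  rw [e1, e2] at h38 h39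
  -- the reduced quantities
  have hαρ : alphaR u G τ₂ ρ z = (U + V) / ρ ^ a := rfl
  have hακ : alphaR u G τ₂ (κ * ρ) z = (Uκ + Vκ) / (κ * ρ) ^ a := rfl
  have hβρ : betaR G ρ z = V / ρ := rfl
  have hpρ : pR p q₀ τ₂ ρ z = P / ρ ^ b := rfl
  have hpκ : pR p q₀ τ₂ (κ * ρ) z = Pκ / (κ * ρ) ^ b := rfl
  set α : ℝ := (U + V) / ρ ^ a with hαdef
  set β : ℝ := V / ρ with hβdef
  set pρ : ℝ := P / ρ ^ b with hpρdef
  have hα0 : 0 ≤ α := div_nonneg (add_nonneg hU0 hV0) (Real.rpow_nonneg hρ.le _)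
  have hβ0 : 0 ≤ β := div_nonneg hV0 hρ.le
  have hpρ0 : 0 ≤ pρ := div_nonneg hP0 (Real.rpow_nonneg hρ.le _)
  rw [hαρ, hακ, hβρ, hpρ, hpκ]
  refine ⟨?_, ?_, ?_⟩
  · -- (13.40)
    refine h38.trans ?_
    rw [mul_add, mul_add, mul_add]
    gcongr ?_ + ?_ + ?_ + ?_
    · -- `C κ^{10/τ₂} α ≤ α/4`
      rw [← mul_assoc]
      calc (C : ℝ) * κ ^ (10 / τ₂) * α ≤ 1 / 4 * α :=
            mul_le_mul_of_nonneg_right (hκle hlam1) hα0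
        _ = α / 4 := by ring
    · -- `C (κ⁻¹)^{a+1} α β^{1/2} ≤ C_κ β^{1/2} α`
      calc (C : ℝ) * (κ⁻¹ ^ (a + 1) * α * β ^ (1 / 2 : ℝ)) = (C : ℝ) * κ⁻¹ ^ (a + 1) * (β ^ (1 / 2 : ℝ) * α) := by
            ring
        _ ≤ Cκ * (β ^ (1 / 2 : ℝ) * α) :=
            mul_le_mul_of_nonneg_right (hκinv (by linarith)) (mul_nonneg (Real.rpow_nonneg hβ0 _) hα0)
        _ = Cκ * β ^ (1 / 2 : ℝ) * α := by ring
    · -- `C (κ⁻¹)^{a+1} ρ^{1-5/τ₂} p^{1/q₀} α^{1/2} ≤ C_κ (ρ^c p)^{1/q₀} α^{1/2}`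
      have hq : ρ ^ (1 - 5 / τ₂) * pρ ^ (1 / q₀) = (ρ ^ c * pρ) ^ (1 / q₀) := by
        rw [Real.mul_rpow (Real.rpow_nonneg hρ.le _) hpρ0, ← Real.rpow_mul hρ.le]
        congr 2
        rw [hc]; field_simp
      calc (C : ℝ) * (κ⁻¹ ^ (a + 1) * ρ ^ (1 - 5 / τ₂) * pρ ^ (1 / q₀) * α ^ (1 / 2 : ℝ))
          = (C : ℝ) * κ⁻¹ ^ (a + 1) * ((ρ ^ c * pρ) ^ (1 / q₀) * α ^ (1 / 2 : ℝ)) := by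
            rw [← hq]; ring
        _ ≤ Cκ * ((ρ ^ c * pρ) ^ (1 / q₀) * α ^ (1 / 2 : ℝ)) :=
            mul_le_mul_of_nonneg_right (hκinv (by linarith))
              (mul_nonneg (Real.rpow_nonneg (mul_nonneg (Real.rpow_nonneg hρ.le _) hpρ0) _)
                (Real.rpow_nonneg hα0 _))
        _ = Cκ * (ρ ^ c * pρ) ^ (1 / q₀) * α ^ (1 / 2 : ℝ) := by ring
    · -- the force term
      calc (C : ℝ) * (κ⁻¹ ^ a * ρ ^ (2 - 5 / τ₀ + 5 / τ₂) * (M : ℝ) ^ (7 / 10 : ℝ) * α ^ (1 / 2 : ℝ))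
          = (C : ℝ) * κ⁻¹ ^ a * ((M : ℝ) ^ (7 / 10 : ℝ) * ρ ^ (2 - 5 / τ₀ + 5 / τ₂) * α ^ (1 / 2 : ℝ)) := by
            ring
        _ ≤ Cκ * ((M : ℝ) ^ (7 / 10 : ℝ) * ρ ^ (2 - 5 / τ₀ + 5 / τ₂) * α ^ (1 / 2 : ℝ)) :=
            mul_le_mul_of_nonneg_right (hκinv (by linarith))
              (mul_nonneg (mul_nonneg (Real.rpow_nonneg M.coe_nonneg _) (Real.rpow_nonneg hρ.le _))
                (Real.rpow_nonneg hα0 _))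
        _ = Cκ * (M : ℝ) ^ (7 / 10 : ℝ) * ρ ^ (2 - 5 / τ₀ + 5 / τ₂) * α ^ (1 / 2 : ℝ) := by ring
  · -- (13.41): multiply (13.39) by `(κρ)^c`
    have hκρc : 0 < (κ * ρ) ^ c := Real.rpow_pos_of_pos hκρ _
    -- the two monomial identities
    have m1 : (κ * ρ) ^ c * κ ^ (10 * q₀ / τ₂ - 2) = κ ^ (c + (10 * q₀ / τ₂ - 2)) * ρ ^ c := by
      rw [Real.mul_rpow hκ0.le hρ.le, Real.rpow_add hκ0]; ring
    have m2 : (κ * ρ) ^ c * κ⁻¹ ^ (5 * q₀ * (2 / 3 - 2 / τ₂)) * ρ ^ (5 * q₀ / τ₂ - q₀) =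
        κ ^ (c - 5 * q₀ * (2 / 3 - 2 / τ₂)) := by
      rw [← Real.exp_log hκ0, ← Real.exp_log hρ]
      simp only [← Real.exp_mul, ← Real.exp_add, ← Real.exp_neg]
      congr 1
      rw [hc]; ring
    calc (κ * ρ) ^ c * (Pκ / (κ * ρ) ^ b)
        ≤ (κ * ρ) ^ c * ((C : ℝ) * (κ ^ (10 * q₀ / τ₂ - 2) * pρ +
            κ⁻¹ ^ (5 * q₀ * (2 / 3 - 2 / τ₂)) * ρ ^ (5 * q₀ / τ₂ - q₀) * α ^ (q₀ / 2) * β ^ (q₀ / 2))) :=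
          mul_le_mul_of_nonneg_left h39 hκρc.le
      _ = (C : ℝ) * κ ^ (c + (10 * q₀ / τ₂ - 2)) * (ρ ^ c * pρ) +
            (C : ℝ) * κ ^ (c - 5 * q₀ * (2 / 3 - 2 / τ₂)) * (α ^ (q₀ / 2) * β ^ (q₀ / 2)) := by
          have := m1; have := m2
          linear_combination (C : ℝ) * pρ * m1 + (C : ℝ) * (α ^ (q₀ / 2) * β ^ (q₀ / 2)) * m2
      _ ≤ 1 / 4 * (ρ ^ c * pρ) + Cκ * (α ^ (q₀ / 2) * β ^ (q₀ / 2)) := by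
          refine add_le_add (mul_le_mul_of_nonneg_right (hκle (by linarith)) (mul_nonneg
            (Real.rpow_nonneg hρ.le _) hpρ0)) (mul_le_mul_of_nonneg_right ?_
            (mul_nonneg (Real.rpow_nonneg hα0 _) (Real.rpow_nonneg hβ0 _)))
          -- `C κ^{c - e₆} ≤ C_κ` since `c - e₆ ≥ -4`
          rw [hCκdef]
          refine mul_le_mul (by linarith) (Real.rpow_le_rpow_of_exponent_ge hκ0 hκ1 ?_)
            (Real.rpow_nonneg hκ0.le _) (by linarith)
          linarith [hc0]
      _ = ρ ^ c * pρ / 4 + Cκ * α ^ (q₀ / 2) * β ^ (q₀ / 2) := by ring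
  · -- (13.44)
    refine h39.trans ?_
    rw [mul_add]
    gcongr ?_ + ?_
    · rw [← mul_assoc]
      calc (C : ℝ) * κ ^ (10 * q₀ / τ₂ - 2) * pρ ≤ 1 / 4 * pρ :=
            mul_le_mul_of_nonneg_right (hκle hlam2) hpρ0
        _ = pρ / 4 := by ring
    · calc (C : ℝ) * (κ⁻¹ ^ (5 * q₀ * (2 / 3 - 2 / τ₂)) * ρ ^ (5 * q₀ / τ₂ - q₀) * α ^ (q₀ / 2) *
            β ^ (q₀ / 2))
          = (C : ℝ) * κ⁻¹ ^ (5 * q₀ * (2 / 3 - 2 / τ₂)) *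
              (ρ ^ (5 * q₀ / τ₂ - q₀) * α ^ (q₀ / 2) * β ^ (q₀ / 2)) := by ring
        _ ≤ Cκ * (ρ ^ (5 * q₀ / τ₂ - q₀) * α ^ (q₀ / 2) * β ^ (q₀ / 2)) :=
            mul_le_mul_of_nonneg_right (hκinv h5e)
              (mul_nonneg (mul_nonneg (Real.rpow_nonneg hρ.le _) (Real.rpow_nonneg hα0 _))
                (Real.rpow_nonneg hβ0 _))
        _ = Cκ * ρ ^ (5 * q₀ / τ₂ - q₀) * α ^ (q₀ / 2) * β ^ (q₀ / 2) := by ring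

end LemarieRieusset2016

end Literature.Analysis.FluidPDE
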